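import Literature.AnabelianGeometry.EtaleTheta.Discharge.Sec5KummerOutTransport
import Literature.AnabelianGeometry.EtaleTheta.Discharge.Sec5BiThetaIsoCanonical
import Literature.AnabelianGeometry.EtaleTheta.Discharge.Sec2CyclotomicRigidityProofs

/-!
# [EtTh] §5, Lemma 5.9 (iv): the intrinsic `K^×`-part of `D` and the canonical one `DK₀` generate the SAME `D` — proofs (p. 332 / PDF p. 106)

Mochizuki, *The étale theta function and its Frobenioid-theoretic manifestations*, Publ. RIMS **45**
(2009) [cite: MochizukiEtTh2009, Lem 5.9 (iv) p.332 (PDF p.106)].  Layer L2 of the abc-iut cell, seat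
abc-iut-L2-t11 (gen 2).  PROOF-ONLY companion (no definitions) of `FrobenioidKummerOut.lean` /
`Discharge/Sec5KummerOutTransport.lean` (this seat: the intrinsic `K^×`-part `BiratAutAction.kummerOut` of
`D ⊆ Out(E^Π_N)`, "conjugation by `(K^×)^{1/N}`", Lemma 5.8) and `Discharge/Sec5BiThetaIsoCanonical.lean` (this
seat, gen 0: the CANONICAL residual datum `DK₀ :=` the preimage of abc-iut-L2-t2's `kummerOut` under transport
along `E^Π_N ≃ₜ* Π^tp_Y[μ_N]` — the `DK` INSTANCE OF RECORD for [EtTh] §5, abc-iut-L2-lead ruling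
2026-08-26T01:44:27Z on finding F-g4-1).

`DK₀` is defined THROUGH the comparison isomorphism of Lemma 5.9 (iv); print defines the `K^×`-part of `D`
intrinsically ("the natural outer actions of `l·ℤ` [cf. (iii)], `K^×` [cf. Lemma 5.8] on `E_N`", p.332 (PDF
p.106); Lemma 5.8: "extends to an outer action of `(K^×)^{1/N}/μ_N(B_N) ⥲ K^×` on `E_N`").  PROVED here, under
the two Kummer-theory inputs of `Sec5KummerOutTransport.lean` (`hinfl`: Kummer cocycles of `N`-th roots of
constants are inflated from `G_K`; `hKum`: "`K^× ↠ (K^×)/(K^×)^N ⥲ H¹(G_K, μ_N)` — where the '`⥲`' is the Kummer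
map", p.273 (PDF p.47)):
* `TopOut.transport_injective` — transport of outer automorphisms along an isomorphism of topological groups is
  injective (from abc-iut-L2-t10's `ThetaEnvData.transport_symm_transport`; bookkeeping for `TopOut.transport`);
* `kummerOut_subset_preimage` — the intrinsic `K^×`-part lies in `DK₀` (⟸ `hinfl`);
* `D_kummerOut_eq`, **`frdBiThetaEnv_kummerOut_eq`, `frdMonoThetaEnv_kummerOut_eq`** — the subgroup
  `D = ⟨galOut ∪ constOut ∪ kummerOut⟩` EQUALS `⟨galOut ∪ constOut ∪ DK₀⟩`, so abc-iut-L2-t4's bi- and mono-theta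
  environment data on `E^Π_N` at the intrinsic `K^×`-part and at `DK₀` COINCIDE (⟸ `hinfl`, `hKum`): the
  instance of record IS print's "`⟨l·ℤ, K^×⟩`"-environment, and every certificate at `DK₀` (Lemma 5.9 (iv):
  `envIsoBiTheta_canonical`; Theorem 5.10 (iii) at `DK₀`, GAP G-L2lead-1) transfers to the intrinsic
  `K^×`-part by rewriting (`frdIsMonoThetaEnv_kummerOut_iff`; v2: `monoThetaEnvCompat_kummerOut_iff` — the
  compatibility clause of Theorem 5.10 (iii), abc-iut-L2-t4's `MonoThetaEnvCompat`, transfers likewise).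
HONEST FRAMING: kernel-checked implications modulo the hypotheses named in each statement; [EtTh] is refereed;
nothing of it is asserted unconditionally; typed ≠ proved; no side is taken on any disputed claim downstream.
-/

namespace Literature.AnabelianGeometry.EtaleTheta

open CategoryTheory

universe w v v' u u'

/-! ### Transport of outer automorphisms is injective -/

/-- Transport of outer automorphisms along an isomorphism of topological groups is injective (transport along
`e⁻¹` undoes it: abc-iut-L2-t10's `ThetaEnvData.transport_symm_transport`).
[cite: MochizukiEtTh2009, Def 2.13 (ii) p.273 (PDF p.47)] -/
theorem TopOut.transport_injective {A B : Type*} [Group A] [Group B] [TopologicalSpace A]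
    [TopologicalSpace B] (e : A ≃ₜ* B) : Function.Injective (TopOut.transport e) := by
  intro x y h
  have h' := congrArg (TopOut.transport e.symm) h
  rwa [ThetaEnvData.transport_symm_transport, ThetaEnvData.transport_symm_transport] at h'

namespace ThetaFrobenioid

variable {C : Type u} [Category.{v} C] {D : Type u'} [Category.{v'} D] {𝔉 : ThetaFrobenioid.{w} C D}

namespace BiratAutAction

section Canonical

variable (α : 𝔉.BiratAutAction) (hK : 𝔉.KxRootNModCyclotome) (H : 𝔉.Facts) (h1 : 𝔉.SectionsFactor)
  (h3 : 𝔉.OuterActionLZ) (hsec : 𝔉.SgpCapSection) (hcs : 𝔉.SgpCupSection) (h8 : 𝔉.ConstantsEqNormalizer)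
  (T : ThetaEnvData.{v} 𝔉.N) (ι : 𝔉.PiX ≃ₜ* T.PiX) (m : 𝔉.muTorsion 𝔉.BN 𝔉.N ≃* T.mu)
  (hY : 𝔉.IdentifiesPiY T ι.toMulEquiv) (hχ : 𝔉.CyclotomicCharacterCompat T ι.toMulEquiv m)

/-- **The intrinsic `K^×`-part lies in the canonical one**: `kummerOut ⊆ DK₀ := transport⁻¹(kummerOut(D_Y))`,
given the inflation input `hinfl`.  [cite: MochizukiEtTh2009, Lem 5.9 (iv) p.332 (PDF p.106)] -/
theorem kummerOut_subset_preimage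
    (hinfl : ∀ f : 𝔉.KxRootN, ∃ δ₀ : T.G → T.mu, ∀ (y : 𝔉.PiX), y ∈ 𝔉.PiY →
      m (α.kummerCocycle hK f (𝔉.sgpCap (𝔉.ρ y))) = δ₀ (T.aug (ι y))) :
    α.kummerOut hK ⊆ TopOut.transport (𝔉.envContIso H T ι m hY hχ) ⁻¹' T.kummerOut := by
  rintro _ ⟨f, rfl⟩
  exact α.transport_kummerOutHom_mem_kummerOut hK H T ι m hY hχ f (hinfl f)

/-- **`D(kummerOut) = D(DK₀)`**: the subgroup of `Out(E^Π_N)` generated by `l·ℤ`, the constants and "conjugation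
by `(K^×)^{1/N}`" equals the one generated with the canonical residual datum `DK₀` in place of the intrinsic
`K^×`-part — `≤` from `kummerOut ⊆ DK₀` (`hinfl`), `≥` because every member of `DK₀` transports into
`kummerOut(D_Y)`, which is reached from `D(kummerOut)` (`kummerOutReached_birat`, `hKum`), and transport is
injective.  [cite: MochizukiEtTh2009, Lem 5.9 (iv) p.332 (PDF p.106)] -/
theorem D_kummerOut_eq
    (hinfl : ∀ f : 𝔉.KxRootN, ∃ δ₀ : T.G → T.mu, ∀ (y : 𝔉.PiX), y ∈ 𝔉.PiY →
      m (α.kummerCocycle hK f (𝔉.sgpCap (𝔉.ρ y))) = δ₀ (T.aug (ι y)))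
    (hKum : ∀ δ₀ : T.G → T.mu, CycEnvelope.IsEnvCocycle T.augY T.chi (δ₀ ∘ T.augY) →
      ∃ (f : 𝔉.KxRootN) (a : T.mu), ∀ p : T.PiY,
        δ₀ (T.augY p) = (α.kummerCocycleY hK f T ι.toMulEquiv m p)⁻¹ * CycEnvelope.coboundary T.augY T.chi a p) :
    (𝔉.frdBiThetaEnv h1 h3 hsec hcs h8 (α.kummerOut hK)).D =
      (𝔉.frdBiThetaEnv h1 h3 hsec hcs h8
        (TopOut.transport (𝔉.envContIso H T ι m hY hχ) ⁻¹' T.kummerOut)).D := by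
  apply le_antisymm
  · exact Subgroup.closure_mono
      (Set.union_subset_union le_rfl (α.kummerOut_subset_preimage hK H T ι m hY hχ hinfl))
  · change Subgroup.closure _ ≤ _
    rw [Subgroup.closure_le]
    rintro x (hx | hx)
    · exact Subgroup.subset_closure (Or.inl hx)
    · obtain ⟨y, hy, hyx⟩ := Subgroup.mem_map.mp
        (α.kummerOutReached_birat hK H T ι m hY hχ h1 h3 hsec hcs h8 hKum hx)
      rw [← TopOut.transport_injective _ hyx]
      exact hy

/-- **The bi-theta environment data on `E^Π_N` at the intrinsic `K^×`-part EQUAL those at `DK₀`**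
(abc-iut-L2-t4's `frdBiThetaEnv`: same group, same `D`, same section classes), given `hinfl`, `hKum`.
[cite: MochizukiEtTh2009, Lem 5.9 (iv) p.332 (PDF p.106)] -/
theorem frdBiThetaEnv_kummerOut_eq
    (hinfl : ∀ f : 𝔉.KxRootN, ∃ δ₀ : T.G → T.mu, ∀ (y : 𝔉.PiX), y ∈ 𝔉.PiY →
      m (α.kummerCocycle hK f (𝔉.sgpCap (𝔉.ρ y))) = δ₀ (T.aug (ι y)))
    (hKum : ∀ δ₀ : T.G → T.mu, CycEnvelope.IsEnvCocycle T.augY T.chi (δ₀ ∘ T.augY) →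
      ∃ (f : 𝔉.KxRootN) (a : T.mu), ∀ p : T.PiY,
        δ₀ (T.augY p) = (α.kummerCocycleY hK f T ι.toMulEquiv m p)⁻¹ * CycEnvelope.coboundary T.augY T.chi a p) :
    𝔉.frdBiThetaEnv h1 h3 hsec hcs h8 (α.kummerOut hK) =
      𝔉.frdBiThetaEnv h1 h3 hsec hcs h8 (TopOut.transport (𝔉.envContIso H T ι m hY hχ) ⁻¹' T.kummerOut) := by
  have hD := α.D_kummerOut_eq hK H h1 h3 hsec hcs h8 T ι m hY hχ hinfl hKum
  exact congrArg (fun D' : Subgroup (TopOut 𝔉.EPiN) =>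
    ({ Pi := 𝔉.EPiN, D := D', sTheta := 𝔉.muConjClass (𝔉.sCupPi h1 hcs).range,
       sAlg := 𝔉.muConjClass (𝔉.sCapPi hsec).range } : BiThetaEnv.{v})) hD

/-- **The mono-theta environment on `E^Π_N` at the intrinsic `K^×`-part EQUALS the one at `DK₀`** ("omitting
the homomorphism `s^⊓-Π_N`", Lemma 5.9 (iv); abc-iut-L2-t4's `frdMonoThetaEnv`), given `hinfl`, `hKum` — so every
certificate at the instance of record `DK₀` (Lemma 5.9 (iv) canonical; Theorem 5.10 (iii) at `DK₀`) is one for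
print's `⟨l·ℤ, K^×⟩`-environment and conversely.  [cite: MochizukiEtTh2009, Lem 5.9 (iv) p.332 (PDF p.106)] -/
theorem frdMonoThetaEnv_kummerOut_eq
    (hinfl : ∀ f : 𝔉.KxRootN, ∃ δ₀ : T.G → T.mu, ∀ (y : 𝔉.PiX), y ∈ 𝔉.PiY →
      m (α.kummerCocycle hK f (𝔉.sgpCap (𝔉.ρ y))) = δ₀ (T.aug (ι y)))
    (hKum : ∀ δ₀ : T.G → T.mu, CycEnvelope.IsEnvCocycle T.augY T.chi (δ₀ ∘ T.augY) →
      ∃ (f : 𝔉.KxRootN) (a : T.mu), ∀ p : T.PiY,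
        δ₀ (T.augY p) = (α.kummerCocycleY hK f T ι.toMulEquiv m p)⁻¹ * CycEnvelope.coboundary T.augY T.chi a p) :
    𝔉.frdMonoThetaEnv h1 h3 hsec hcs h8 (α.kummerOut hK) =
      𝔉.frdMonoThetaEnv h1 h3 hsec hcs h8 (TopOut.transport (𝔉.envContIso H T ι m hY hχ) ⁻¹' T.kummerOut) := by
  unfold ThetaFrobenioid.frdMonoThetaEnv
  rw [α.frdBiThetaEnv_kummerOut_eq hK H h1 h3 hsec hcs h8 T ι m hY hχ hinfl hKum]

/-- **Lemma 5.9 (iv) "In particular" transfers between the two readings of the `K^×`-part**: abc-iut-L2-t4's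
`FrdIsMonoThetaEnv` ("`E^Π_N` IS a mod `N` mono-theta environment") at the intrinsic `K^×`-part `kummerOut` and
at the instance of record `DK₀` are EQUIVALENT (given `hinfl`, `hKum`), for any comparison data `T'`.
[cite: MochizukiEtTh2009, Lem 5.9 (iv) p.332 (PDF p.106)] -/
theorem frdIsMonoThetaEnv_kummerOut_iff
    (hinfl : ∀ f : 𝔉.KxRootN, ∃ δ₀ : T.G → T.mu, ∀ (y : 𝔉.PiX), y ∈ 𝔉.PiY →
      m (α.kummerCocycle hK f (𝔉.sgpCap (𝔉.ρ y))) = δ₀ (T.aug (ι y)))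
    (hKum : ∀ δ₀ : T.G → T.mu, CycEnvelope.IsEnvCocycle T.augY T.chi (δ₀ ∘ T.augY) →
      ∃ (f : 𝔉.KxRootN) (a : T.mu), ∀ p : T.PiY,
        δ₀ (T.augY p) = (α.kummerCocycleY hK f T ι.toMulEquiv m p)⁻¹ * CycEnvelope.coboundary T.augY T.chi a p)
    (T' : ThetaEnvData.{v} 𝔉.N) :
    𝔉.FrdIsMonoThetaEnv h1 h3 hsec hcs h8 (α.kummerOut hK) T' ↔
      𝔉.FrdIsMonoThetaEnv h1 h3 hsec hcs h8
        (TopOut.transport (𝔉.envContIso H T ι m hY hχ) ⁻¹' T.kummerOut) T' := by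
  unfold ThetaFrobenioid.FrdIsMonoThetaEnv
  rw [α.frdMonoThetaEnv_kummerOut_eq hK H h1 h3 hsec hcs h8 T ι m hY hχ hinfl hKum]

end Canonical

/-! ### The inflation input from geometric connectedness ("since `Y` is geometrically connected over `K`", proof of Lemma 5.8) -/

section Geometric

variable (α : 𝔉.BiratAutAction) (hK : 𝔉.KxRootNModCyclotome) (T : ThetaEnvData.{v} 𝔉.N) (ι : 𝔉.PiX ≃ₜ* T.PiX)
  (m : 𝔉.muTorsion 𝔉.BN 𝔉.N ≃* T.mu)

/-- `κ_f(e) = 1` when `e` fixes `f`. [cite: MochizukiEtTh2009, Lem 5.8 proof p.331 (PDF p.105)] -/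
theorem kummerCocycle_eq_one_of_act_eq (f : 𝔉.KxRootN) {e : Aut 𝔉.BN}
    (he : α.act e (f : 𝔉.biratUnits 𝔉.BN) = f) : α.kummerCocycle hK f e = 1 := by
  apply 𝔉.muToBirat_injective
  rw [α.muToBirat_kummerCocycle, he, mul_inv_cancel, map_one]

/-- If `s^⊓-gp_N(ρ d)` fixes `f`, then `κ_f(s^⊓-gp_N(ρ(y·d))) = κ_f(s^⊓-gp_N(ρ y))` (cocycle law).
[cite: MochizukiEtTh2009, Lem 5.8 proof p.331 (PDF p.105)] -/
theorem kummerCocycle_sgpCap_mul_eq (f : 𝔉.KxRootN) (y : 𝔉.PiX) {d : 𝔉.PiX}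
    (hd : α.act (𝔉.sgpCap (𝔉.ρ d)) (f : 𝔉.biratUnits 𝔉.BN) = f) :
    α.kummerCocycle hK f (𝔉.sgpCap (𝔉.ρ (y * d))) = α.kummerCocycle hK f (𝔉.sgpCap (𝔉.ρ y)) := by
  rw [map_mul, map_mul, α.kummerCocycle_mul, α.kummerCocycle_eq_one_of_act_eq hK f hd]
  have h1 : conjMu (𝔉.sgpCap (𝔉.ρ y)) (1 : 𝔉.muTorsion 𝔉.BN 𝔉.N) = 1 :=
    Subtype.ext (by change 𝔉.sgpCap (𝔉.ρ y) * 1 * (𝔉.sgpCap (𝔉.ρ y))⁻¹ = 1; group)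
  rw [h1, mul_one]

/-- **The inflation input `hinfl` of `Sec5KummerOutTransport.lean` FROM GEOMETRIC CONNECTEDNESS**: if the
elements of `Π^tp_Y̲` over `1 ∈ G_K` (i.e. of `Δ^tp_Y`) fix the `N`-th roots of constants through
`s^⊓-gp_N ∘ ρ` (`hgeom` — print, proof of Lemma 5.8, p.331 (PDF p.105): "since `Y` is geometrically connected
over `K` … `Π^tp_Y` [i.e., `G_K`, via the natural surjection `Π^tp_Y ↠ G_K`] acts"), then the Kummer cocycle of
every `f ∈ (K^×)^{1/N}` read on `Π^tp_Y` is inflated from `G_K`.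
[cite: MochizukiEtTh2009, Lem 5.8 proof p.331 (PDF p.105)] -/
theorem hinfl_of_geometric
    (hgeom : ∀ (f : 𝔉.KxRootN) (y : 𝔉.PiX), y ∈ 𝔉.PiY → T.aug (ι y) = 1 →
      α.act (𝔉.sgpCap (𝔉.ρ y)) (f : 𝔉.biratUnits 𝔉.BN) = f)
    (f : 𝔉.KxRootN) :
    ∃ δ₀ : T.G → T.mu, ∀ (y : 𝔉.PiX), y ∈ 𝔉.PiY →
      m (α.kummerCocycle hK f (𝔉.sgpCap (𝔉.ρ y))) = δ₀ (T.aug (ι y)) := by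
  classical
  refine ⟨fun g => if h : ∃ y' ∈ 𝔉.PiY, T.aug (ι y') = g then
      m (α.kummerCocycle hK f (𝔉.sgpCap (𝔉.ρ h.choose))) else 1, ?_⟩
  intro y hy
  have h : ∃ y' ∈ 𝔉.PiY, T.aug (ι y') = T.aug (ι y) := ⟨y, hy, rfl⟩
  dsimp only
  rw [dif_pos h]
  obtain ⟨hy', he⟩ := h.choose_spec
  have hd : T.aug (ι (y⁻¹ * h.choose)) = 1 := by
    rw [map_mul, map_inv, map_mul, map_inv, he, inv_mul_cancel]
  have key := α.kummerCocycle_sgpCap_mul_eq hK f y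
    (hgeom f (y⁻¹ * h.choose) (𝔉.PiY.mul_mem (𝔉.PiY.inv_mem hy) hy') hd)
  rw [mul_inv_cancel_left] at key
  rw [key]

/-- The constants' form of the inflation input (`hinflAll` of this seat's `Sec5ConstantsKummer.lean` /
`Sec5BiThetaIsoCanonical.lean`, over abc-iut-L2-t4's `(O_K^×)^{1/N}`) FOLLOWS from `hinfl` (hence from `hgeom`):
for `u ∈ (O_K^×)^{1/N}` the commutator `u ∘ s ∘ u⁻¹ ∘ s⁻¹` is `κ_u(s)⁻¹`.
[cite: MochizukiEtTh2009, Lem 5.8 proof p.331 (PDF p.105)] -/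
theorem hinflAll_of_hinfl
    (hinfl : ∀ f : 𝔉.KxRootN, ∃ δ₀ : T.G → T.mu, ∀ (y : 𝔉.PiX), y ∈ 𝔉.PiY →
      m (α.kummerCocycle hK f (𝔉.sgpCap (𝔉.ρ y))) = δ₀ (T.aug (ι y))) :
    ∀ u ∈ 𝔉.OKxRootN, ∃ δ₀ : T.G → T.mu, ∀ (y : 𝔉.PiX) (_ : y ∈ 𝔉.PiY)
      (hc : u * 𝔉.sgpCap (𝔉.ρ y) * u⁻¹ * (𝔉.sgpCap (𝔉.ρ y))⁻¹ ∈ 𝔉.muTorsion 𝔉.BN 𝔉.N),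
      m ⟨_, hc⟩ = δ₀ (T.aug (ι y)) := by
  rintro _ ⟨u₀, hu₀, rfl⟩
  obtain ⟨δ₀, hδ₀⟩ := hinfl ⟨_, hu₀⟩
  refine ⟨fun g => (δ₀ g)⁻¹, fun y hy hc => ?_⟩
  have hκ : (⟨_, hc⟩ : 𝔉.muTorsion 𝔉.BN 𝔉.N) = (α.kummerCocycle hK ⟨_, hu₀⟩ (𝔉.sgpCap (𝔉.ρ y)))⁻¹ := by
    apply Subtype.ext
    rw [Subgroup.coe_inv, α.coe_kummerCocycle_unit hK u₀ hu₀]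
    change (u₀ : Aut 𝔉.BN) * 𝔉.sgpCap (𝔉.ρ y) * (u₀ : Aut 𝔉.BN)⁻¹ * (𝔉.sgpCap (𝔉.ρ y))⁻¹ = _
    group
  rw [hκ, map_inv, hδ₀ y hy]

end Geometric

/-! ### Lemma 5.9 (iv) at the instance of record `DK₀` from the birational action + geometric connectedness -/

section CanonicalGeometric

variable (α : 𝔉.BiratAutAction) (hK : 𝔉.KxRootNModCyclotome) (H : 𝔉.Facts) (h1 : 𝔉.SectionsFactor)
  (h3 : 𝔉.OuterActionLZ) (hsec : 𝔉.SgpCapSection) (hcs : 𝔉.SgpCupSection) (h8 : 𝔉.ConstantsEqNormalizer)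
  (T : ThetaEnvData.{v} 𝔉.N) (ι : 𝔉.PiX ≃ₜ* T.PiX) (m : 𝔉.muTorsion 𝔉.BN 𝔉.N ≃* T.mu)
  (hY : 𝔉.IdentifiesPiY T ι.toMulEquiv) (hYdd : 𝔉.IdentifiesPiYdd T ι.toMulEquiv)
  (hχX : 𝔉.CyclotomicCharacterCompatX T ι.toMulEquiv m)

include hK in
/-- **[EtTh] Lemma 5.9 (iv) at the `DK` instance of record `DK₀`, with the constants' inflation hypothesis of
`envIsoBiTheta_canonical` (this seat, gen 0) REPLACED by the primitive input "`Δ^tp_Y` fixes the `N`-th roots of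
constants" (`hgeom`, geometric connectedness of `Y` over `K`, proof of Lemma 5.8) read through a birational action
`α`** — the remaining hypotheses are `Facts`, `ι`, `m`, `CyclotomicCharacterCompatX`, the Prop. 5.2 (iii) dictionary
and `KxRootNModCyclotome`.  [cite: MochizukiEtTh2009, Lem 5.9 (iv) p.332 (PDF p.106)] -/
theorem envIsoBiTheta_canonical_of_geometric {η : T.PiYdd → T.mu} (hη : η ∈ T.thetaCocycles)
    (hcompat : 𝔉.ThetaSectionCompat H T ι.toMulEquiv m hYdd η)
    (hgeom : ∀ (f : 𝔉.KxRootN) (y : 𝔉.PiX), y ∈ 𝔉.PiY → T.aug (ι y) = 1 →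
      α.act (𝔉.sgpCap (𝔉.ρ y)) (f : 𝔉.biratUnits 𝔉.BN) = f) :
    𝔉.EnvIsoBiTheta h1 h3 hsec hcs h8
      (TopOut.transport (𝔉.envContIso H T ι m hY hχX.toY) ⁻¹' T.kummerOut) T ι :=
  𝔉.envIsoBiTheta_canonical H h1 h3 hsec hcs h8 T ι m hY hYdd hχX hη hcompat
    (α.hinflAll_of_hinfl hK T ι m (α.hinfl_of_geometric hK T ι m hgeom))

include hK in
/-- … and its "In particular" (`FrdIsMonoThetaEnv` at `DK₀`). [cite: MochizukiEtTh2009, Lem 5.9 (iv) p.332 (PDF p.106)] -/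
theorem frdIsMonoThetaEnv_canonical_of_geometric {η : T.PiYdd → T.mu} (hη : η ∈ T.thetaCocycles)
    (hcompat : 𝔉.ThetaSectionCompat H T ι.toMulEquiv m hYdd η)
    (hgeom : ∀ (f : 𝔉.KxRootN) (y : 𝔉.PiX), y ∈ 𝔉.PiY → T.aug (ι y) = 1 →
      α.act (𝔉.sgpCap (𝔉.ρ y)) (f : 𝔉.biratUnits 𝔉.BN) = f) :
    𝔉.FrdIsMonoThetaEnv h1 h3 hsec hcs h8
      (TopOut.transport (𝔉.envContIso H T ι m hY hχX.toY) ⁻¹' T.kummerOut) T :=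
  𝔉.frdIsMonoThetaEnv_of h1 h3 hsec hcs h8 _ T ι
    (α.envIsoBiTheta_canonical_of_geometric hK H h1 h3 hsec hcs h8 T ι m hY hYdd hχX hη hcompat hgeom)

end CanonicalGeometric

/-! ### Theorem 5.10 (iii)'s compatibility predicate transfers between the two readings of the `K^×`-part -/

section Compat

variable (α : 𝔉.BiratAutAction) (hK : 𝔉.KxRootNModCyclotome) (H : 𝔉.Facts) (h1 : 𝔉.SectionsFactor)
  (h3 : 𝔉.OuterActionLZ) (hsec : 𝔉.SgpCapSection) (hcs : 𝔉.SgpCupSection) (h8 : 𝔉.ConstantsEqNormalizer)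
  (T : ThetaEnvData.{v} 𝔉.N) (ι : 𝔉.PiX ≃ₜ* T.PiX) (m : 𝔉.muTorsion 𝔉.BN 𝔉.N ≃* T.mu)
  (hY : 𝔉.IdentifiesPiY T ι.toMulEquiv) (hχ : 𝔉.CyclotomicCharacterCompat T ι.toMulEquiv m)

set_option maxHeartbeats 400000 in
/-- **Theorem 5.10 (iii)'s compatibility clause (abc-iut-L2-t4's `MonoThetaEnvCompat`) at the intrinsic `K^×`-part
and at the instance of record `DK₀` are EQUIVALENT** (given `hinfl`, `hKum`): an automorphism `γ` of mono-theta
environments for one `D` is one for the other, the two `D`'s being EQUAL (`D_kummerOut_eq`).  So a certificate of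
"print's 𝕄(𝔉) at `DK₀`" (GAP G-L2lead-1) is verbatim one for the `⟨l·ℤ, K^×⟩`-environment of Lemma 5.9 (iv) and
conversely.  [cite: MochizukiEtTh2009, Thm 5.10 (iii) p.334 (PDF p.108)] -/
theorem monoThetaEnvCompat_kummerOut_iff
    (hinfl : ∀ f : 𝔉.KxRootN, ∃ δ₀ : T.G → T.mu, ∀ (y : 𝔉.PiX), y ∈ 𝔉.PiY →
      m (α.kummerCocycle hK f (𝔉.sgpCap (𝔉.ρ y))) = δ₀ (T.aug (ι y)))
    (hKum : ∀ δ₀ : T.G → T.mu, CycEnvelope.IsEnvCocycle T.augY T.chi (δ₀ ∘ T.augY) →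
      ∃ (f : 𝔉.KxRootN) (a : T.mu), ∀ p : T.PiY,
        δ₀ (T.augY p) = (α.kummerCocycleY hK f T ι.toMulEquiv m p)⁻¹ * CycEnvelope.coboundary T.augY T.chi a p)
    (Ψ : C ≌ C) (β : Ψ.functor.obj 𝔉.BN ≅ 𝔉.BN) (ψY : 𝔉.PiX ≃ₜ* 𝔉.PiX)
    (hbase : ∀ g : 𝔉.PiX, 𝔉.autBase 𝔉.BN (𝔉.psiAut Ψ β (𝔉.sgpCap (𝔉.ρ g))) = 𝔉.ρ (ψY g))
    (hψY : 𝔉.PiY.map ψY.toMulEquiv.toMonoidHom = 𝔉.PiY)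
    (hψYdd : 𝔉.PiYdd.map ψY.toMulEquiv.toMonoidHom = 𝔉.PiYdd) :
    𝔉.MonoThetaEnvCompat h1 h3 hsec hcs h8 (α.kummerOut hK) Ψ β ψY hbase hψY hψYdd ↔
      𝔉.MonoThetaEnvCompat h1 h3 hsec hcs h8
        (TopOut.transport (𝔉.envContIso H T ι m hY hχ) ⁻¹' T.kummerOut) Ψ β ψY hbase hψY hψYdd := by
  have hD := α.D_kummerOut_eq hK H h1 h3 hsec hcs h8 T ι m hY hχ hinfl hKum
  constructor
  · rintro ⟨x₃, γ, k, hk, hx⟩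
    refine ⟨x₃, ⟨γ.e, ?_, γ.map_sTheta⟩, k, hk, hx⟩
    change ((𝔉.frdBiThetaEnv h1 h3 hsec hcs h8
        (TopOut.transport (𝔉.envContIso H T ι m hY hχ) ⁻¹' T.kummerOut)).D).map _ =
      (𝔉.frdBiThetaEnv h1 h3 hsec hcs h8 (TopOut.transport (𝔉.envContIso H T ι m hY hχ) ⁻¹' T.kummerOut)).D
    rw [← hD]
    exact γ.map_D
  · rintro ⟨x₃, γ, k, hk, hx⟩
    refine ⟨x₃, ⟨γ.e, ?_, γ.map_sTheta⟩, k, hk, hx⟩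
    change ((𝔉.frdBiThetaEnv h1 h3 hsec hcs h8 (α.kummerOut hK)).D).map _ =
      (𝔉.frdBiThetaEnv h1 h3 hsec hcs h8 (α.kummerOut hK)).D
    rw [hD]
    exact γ.map_D

end Compat

end BiratAutAction

end ThetaFrobenioid

end Literature.AnabelianGeometry.EtaleTheta
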